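import Mathlib.MeasureTheory.Group.Measure
import Mathlib.MeasureTheory.Integral.Prod
import Summits.QuantumFields.QCD.Theorems.PauliWegnerSeaSingleLinkLogFlatnessCircle

/-!
# Route `PauliWegnerSea`, item `SingleLinkLogFlatness` (stmt-QuantumFields-11516) — abstract core

**Mahler's inequality along circle words** (`norm_mul_exp_neg_le_exp_integral_log`): let `μ` be a
right-invariant probability measure on a topological group `G`, `cs` a list of continuous letters
`c : ℝ → G` such that the words `g · c₁(θ₁) ⋯ c_k(θ_k)` from any `g` reach a given `g₀`, and
`F : G → ℂ` bounded measurable such that along every letter, with arbitrary right factor,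
`‖F(g c(θ) h)‖ = ‖q(e^{iθ})‖` for some `q ∈ ℂ[X]` with `deg q ≤ n`.  Then
`‖F g₀‖ · 2^{-k n} ≤ exp ∫ log ‖F‖ dμ`.

Proof: for the truncation `φ_N = log (max ‖F‖ e^{-N})`, the letter averages
`g ↦ (2π)⁻¹ ∫₀^{2π} φ(g c(θ)) dθ` preserve boundedness, measurability and — by Fubini and right
invariance — the integral against `μ` (`integral_foldr`); iterating the one-circle Mahler step
(`circle_step`, file `…Circle`) along the word reaching `g₀` bounds the iterated average below by
`φ_N(g₀) - k n log 2` pointwise (`le_foldr`); hence `∫ max (log ‖F‖) (-N) dμ ≥ log ‖F g₀‖ - k n log 2`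
for every `N`, and `N → ∞` (`le_integral_of_le_integral_max`).  This is the mechanism by which a
compact group inherits the one-variable Mahler inequality without any explicit Haar density: only
right invariance and a surjective circle word are used.  All statements [folklore]; no definitions
(letter averages are written inline as `List.foldr`).
-/

noncomputable section

namespace Summit.QuantumFields.QCD.Theorems.SingleLinkLogFlatness

open MeasureTheory Real Polynomial Complex Set Filter

/-! ### Circle averages on a group with a right-invariant finite measure -/

section Group

variable {G : Type*} [Group G] [TopologicalSpace G] [IsTopologicalGroup G] [MeasurableSpace G]
  [BorelSpace G]

/-- A letter average `g ↦ (2π)⁻¹ ∫₀^{2π} φ(g·c(θ)) dθ` of a bounded measurable `φ` is measurable and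
obeys the same bound. [folklore] -/
theorem avg_measurable_bound {c : ℝ → G} (hc : Continuous c) {φ : G → ℝ} (hφm : Measurable φ)
    {B : ℝ} (hφb : ∀ g, |φ g| ≤ B) :
    Measurable (fun g => (2 * π)⁻¹ * ∫ θ in (0)..(2 * π), φ (g * c θ)) ∧
      ∀ g, |(2 * π)⁻¹ * ∫ θ in (0)..(2 * π), φ (g * c θ)| ≤ B := by
  have h2π : (0 : ℝ) ≤ 2 * π := by positivity
  constructor
  · have hmeas : Measurable fun p : G × ℝ => φ (p.1 * c p.2) :=
      hφm.comp (continuous_fst.mul (hc.comp continuous_snd)).measurable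
    have hsm := (hmeas.stronglyMeasurable).integral_prod_right'
      (ν := volume.restrict (Set.Ioc 0 (2 * π)))
    simp_rw [intervalIntegral.integral_of_le h2π]
    exact hsm.measurable.const_mul _
  · intro g
    have h := intervalIntegral.norm_integral_le_of_norm_le_const (a := 0) (b := 2 * π)
      (f := fun θ => φ (g * c θ)) (C := B) (fun θ _ => by
        rw [Real.norm_eq_abs]; exact hφb (g * c θ))
    rw [Real.norm_eq_abs, sub_zero, abs_of_nonneg h2π] at h
    rw [abs_mul, abs_inv, abs_of_nonneg h2π]
    calc (2 * π)⁻¹ * |∫ θ in (0)..(2 * π), φ (g * c θ)| ≤ (2 * π)⁻¹ * (B * (2 * π)) :=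
          mul_le_mul_of_nonneg_left h (inv_nonneg.2 h2π)
      _ = B := by field_simp

/-- A letter average does not change the integral against a right-invariant finite measure
(Fubini and right invariance). [folklore] -/
theorem integral_avg (μ : Measure G) [IsFiniteMeasure μ] [μ.IsMulRightInvariant]
    {c : ℝ → G} (hc : Continuous c) {φ : G → ℝ} (hφm : Measurable φ) {B : ℝ} (hφb : ∀ g, |φ g| ≤ B) :
    ∫ g, ((2 * π)⁻¹ * ∫ θ in (0)..(2 * π), φ (g * c θ)) ∂μ = ∫ g, φ g ∂μ := by
  have h2π : (0 : ℝ) ≤ 2 * π := by positivity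
  simp_rw [intervalIntegral.integral_of_le h2π]
  rw [integral_const_mul]
  have hint : Integrable (Function.uncurry fun g θ => φ (g * c θ))
      (μ.prod (volume.restrict (Set.Ioc 0 (2 * π)))) := by
    refine Integrable.of_bound ?_ B (Eventually.of_forall fun p => ?_)
    · exact (hφm.comp (continuous_fst.mul (hc.comp continuous_snd)).measurable).aestronglyMeasurable
    · rw [Real.norm_eq_abs]; exact hφb _
  rw [integral_integral_swap hint]
  simp only [integral_mul_right_eq_self (fun g => φ g)]
  rw [setIntegral_const, smul_eq_mul, measureReal_def, Real.volume_Ioc, sub_zero,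
    ENNReal.toReal_ofReal h2π]
  field_simp

/-- Iterated letter averages of a bounded measurable function are measurable with the same bound.
[folklore] -/
theorem foldr_measurable_bound (cs : List (ℝ → G)) (hcs : ∀ c ∈ cs, Continuous c) {φ : G → ℝ}
    (hφm : Measurable φ) {B : ℝ} (hφb : ∀ g, |φ g| ≤ B) :
    Measurable (cs.foldr (fun c ψ g => (2 * π)⁻¹ * ∫ θ in (0)..(2 * π), ψ (g * c θ)) φ) ∧
      ∀ g, |cs.foldr (fun c ψ g => (2 * π)⁻¹ * ∫ θ in (0)..(2 * π), ψ (g * c θ)) φ g| ≤ B := by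
  induction cs with
  | nil => exact ⟨hφm, hφb⟩
  | cons c cs ih =>
    obtain ⟨ihm, ihb⟩ := ih fun c' hc' => hcs c' (List.mem_cons_of_mem _ hc')
    simp only [List.foldr_cons]
    exact avg_measurable_bound (hcs c List.mem_cons_self) ihm ihb

/-- Iterated letter averages do not change the integral against a right-invariant finite measure.
[folklore] -/
theorem integral_foldr (μ : Measure G) [IsFiniteMeasure μ] [μ.IsMulRightInvariant]
    (cs : List (ℝ → G)) (hcs : ∀ c ∈ cs, Continuous c) {φ : G → ℝ} (hφm : Measurable φ) {B : ℝ}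
    (hφb : ∀ g, |φ g| ≤ B) :
    ∫ g, (cs.foldr (fun c ψ g => (2 * π)⁻¹ * ∫ θ in (0)..(2 * π), ψ (g * c θ)) φ g) ∂μ =
      ∫ g, φ g ∂μ := by
  induction cs with
  | nil => rfl
  | cons c cs ih =>
    have hcs' : ∀ c' ∈ cs, Continuous c' := fun c' hc' => hcs c' (List.mem_cons_of_mem _ hc')
    obtain ⟨ihm, ihb⟩ := foldr_measurable_bound cs hcs' hφm hφb
    simp only [List.foldr_cons]
    rw [integral_avg μ (hcs c List.mem_cons_self) ihm ihb, ih hcs']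

/-- **Mahler along a circle word (truncated, pointwise).** If along every letter `c ∈ cs` the
function `F` is a trigonometric polynomial of degree `≤ n` in norm (`‖F(g c(θ) h)‖ = ‖q(e^{iθ})‖`,
`deg q ≤ n`), then the iterated letter average of `log (max ‖F‖ e^{-N})` at `g` dominates its value at
every word `g · c₁(θ₁) ⋯ c_k(θ_k)` up to `k · n log 2` (induction on the word, one `circle_step` per
letter). [folklore] -/
theorem le_foldr (cs : List (ℝ → G)) (hcs : ∀ c ∈ cs, Continuous c) {F : G → ℂ}
    (hFm : Measurable F) {B : ℝ} (hFb : ∀ g, ‖F g‖ ≤ B) {n : ℕ}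
    (hq : ∀ c ∈ cs, ∀ g h : G, ∃ q : ℂ[X], q.natDegree ≤ n ∧
      ∀ θ : ℝ, ‖F (g * c θ * h)‖ = ‖q.eval (cexp (θ * I))‖)
    (N : ℝ) (g : G) (θs : List ℝ) (hlen : θs.length = cs.length) :
    Real.log (max ‖F (g * (List.zipWith (fun c θ => c θ) cs θs).prod)‖ (Real.exp (-N))) -
        cs.length * (n * Real.log 2) ≤
      cs.foldr (fun c ψ g => (2 * π)⁻¹ * ∫ θ in (0)..(2 * π), ψ (g * c θ))
        (fun g => Real.log (max ‖F g‖ (Real.exp (-N)))) g := by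
  have h2π : (0 : ℝ) ≤ 2 * π := by positivity
  have hφm : Measurable fun g => Real.log (max ‖F g‖ (Real.exp (-N))) :=
    (continuous_logTrunc N).measurable.comp hFm.norm
  have hφb : ∀ g, |Real.log (max ‖F g‖ (Real.exp (-N)))| ≤
      max |(-N : ℝ)| |Real.log (max B (Real.exp (-N)))| := fun g =>
    abs_le_max_abs_abs (neg_le_logTrunc N ‖F g‖) (logTrunc_mono N (hFb g))
  induction cs generalizing g θs with
  | nil =>
    cases θs with
    | nil => simp
    | cons _ _ => simp at hlen
  | cons c cs ih =>
    obtain ⟨θ₁, θs, rfl⟩ : ∃ θ₁ θs', θs = θ₁ :: θs' := by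
      cases θs with
      | nil => simp at hlen
      | cons a b => exact ⟨a, b, rfl⟩
    have hcs' : ∀ c' ∈ cs, Continuous c' := fun c' hc' => hcs c' (List.mem_cons_of_mem _ hc')
    have hc : Continuous c := hcs c List.mem_cons_self
    have hq' : ∀ c' ∈ cs, ∀ g h : G, ∃ q : ℂ[X], q.natDegree ≤ n ∧
        ∀ θ : ℝ, ‖F (g * c' θ * h)‖ = ‖q.eval (cexp (θ * I))‖ :=
      fun c' hc' => hq c' (List.mem_cons_of_mem _ hc')
    simp only [List.length_cons, Nat.succ.injEq] at hlen
    simp only [List.zipWith_cons_cons, List.prod_cons, List.foldr_cons, List.length_cons,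
      Nat.cast_add, Nat.cast_one]
    set P' := (List.zipWith (fun c θ => c θ) cs θs).prod with hP'
    set Φ := cs.foldr (fun c ψ g => (2 * π)⁻¹ * ∫ θ in (0)..(2 * π), ψ (g * c θ))
      (fun g => Real.log (max ‖F g‖ (Real.exp (-N)))) with hΦ
    -- pointwise induction hypothesis along the first letter
    have h1 : ∀ θ, Real.log (max ‖F (g * c θ * P')‖ (Real.exp (-N))) - cs.length * (n * Real.log 2) ≤
        Φ (g * c θ) := fun θ => by
      have := ih hcs' hq' (g * c θ) θs hlen
      rwa [mul_assoc] at this ⊢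
    obtain ⟨hΦm, hΦb⟩ := foldr_measurable_bound cs hcs' hφm hφb
    -- the first letter: one circle step with right factor `P'`
    obtain ⟨q, hqn, hqθ⟩ := hq c List.mem_cons_self g P'
    have h3 := circle_step N q hqn θ₁
    simp_rw [← hqθ] at h3
    -- integrate the pointwise bound
    have h4 : ∫ θ in (0)..(2 * π), (Real.log (max ‖F (g * c θ * P')‖ (Real.exp (-N))) -
        cs.length * (n * Real.log 2)) ≤ ∫ θ in (0)..(2 * π), Φ (g * c θ) := by
      refine intervalIntegral.integral_mono_on h2π ?_ ?_ fun θ _ => h1 θ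
      · simp_rw [hqθ]
        exact (((continuous_logTrunc N).comp (continuous_norm.comp (q.continuous.comp
          (by fun_prop)))).sub continuous_const).intervalIntegrable _ _
      · rw [intervalIntegrable_iff_integrableOn_Ioc_of_le h2π]
        refine Measure.integrableOn_of_bounded (M := max |(-N : ℝ)| |Real.log (max B (Real.exp (-N)))|)
          (by rw [Real.volume_Ioc]; exact ENNReal.ofReal_ne_top) ?_ ?_
        · exact (hΦm.comp (continuous_const.mul hc).measurable).aestronglyMeasurable
        · exact Eventually.of_forall fun θ => by rw [Real.norm_eq_abs]; exact hΦb _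
    have h5 : (2 * π)⁻¹ * ∫ θ in (0)..(2 * π), (Real.log (max ‖F (g * c θ * P')‖ (Real.exp (-N))) -
        cs.length * (n * Real.log 2)) =
        (2 * π)⁻¹ * (∫ θ in (0)..(2 * π), Real.log (max ‖F (g * c θ * P')‖ (Real.exp (-N)))) -
          cs.length * (n * Real.log 2) := by
      rw [intervalIntegral.integral_sub _ intervalIntegrable_const, intervalIntegral.integral_const,
        sub_zero, smul_eq_mul]
      · field_simp
      · simp_rw [hqθ]
        exact ((continuous_logTrunc N).comp (continuous_norm.comp (q.continuous.comp
          (by fun_prop)))).intervalIntegrable _ _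
    have h6 := mul_le_mul_of_nonneg_left h4 (inv_nonneg.2 h2π)
    rw [h5] at h6
    have h7 : g * (c θ₁ * P') = g * c θ₁ * P' := (mul_assoc _ _ _).symm
    rw [h7]
    linarith

/-- **Truncated lower bound.** Under the hypotheses of `norm_mul_exp_neg_le_exp_integral_log` and
`F g₀ ≠ 0`: `log ‖F g₀‖ - |cs| n log 2 ≤ ∫ max (log ‖F‖) (-N) dμ` for every `N` — the chain
`∫ max (log ‖F‖) (-N) ≥ ∫ log (max ‖F‖ e^{-N}) = ∫ (iterated letter average)` (`integral_foldr`)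
`≥ log (max ‖F g₀‖ e^{-N}) - |cs| n log 2` (`le_foldr` at the word reaching `g₀`). [folklore] -/
theorem le_integral_max_log_norm (μ : Measure G) [IsProbabilityMeasure μ]
    [μ.IsMulRightInvariant] (cs : List (ℝ → G)) (hcs : ∀ c ∈ cs, Continuous c) {F : G → ℂ}
    (hFm : Measurable F) {B : ℝ} (hFb : ∀ g, ‖F g‖ ≤ B) {n : ℕ}
    (hq : ∀ c ∈ cs, ∀ g h : G, ∃ q : ℂ[X], q.natDegree ≤ n ∧
      ∀ θ : ℝ, ‖F (g * c θ * h)‖ = ‖q.eval (cexp (θ * I))‖)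
    (g₀ : G) (hreach : ∀ g : G, ∃ θs : List ℝ, θs.length = cs.length ∧
      g * (List.zipWith (fun c θ => c θ) cs θs).prod = g₀) (h0 : F g₀ ≠ 0) (N : ℕ) :
    Real.log ‖F g₀‖ - cs.length * (n * Real.log 2) ≤ ∫ g, max (Real.log ‖F g‖) (-(N : ℝ)) ∂μ := by
  have hpos : 0 < ‖F g₀‖ := norm_pos_iff.2 h0
  set C : ℝ := cs.length * (n * Real.log 2) with hC
  have hB : 0 ≤ B := (norm_nonneg _).trans (hFb g₀)
  have hφm : Measurable fun g => Real.log (max ‖F g‖ (Real.exp (-(N : ℝ)))) :=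
    (continuous_logTrunc N).measurable.comp hFm.norm
  have hφb : ∀ g, |Real.log (max ‖F g‖ (Real.exp (-(N : ℝ))))| ≤
      max |(-(N : ℝ))| |Real.log (max B (Real.exp (-(N : ℝ))))| := fun g =>
    abs_le_max_abs_abs (neg_le_logTrunc N ‖F g‖) (logTrunc_mono N (hFb g))
  obtain ⟨hΦm, hΦb⟩ := foldr_measurable_bound cs hcs hφm hφb
  have hmaxint : Integrable (fun g => max (Real.log ‖F g‖) (-(N : ℝ))) μ :=
    Integrable.of_bound ((Real.measurable_log.comp hFm.norm).max measurable_const).aestronglyMeasurable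
      (max |(-(N : ℝ))| |(|Real.log B|)|) (Eventually.of_forall fun g => by
        rw [Real.norm_eq_abs]
        refine abs_le_max_abs_abs (le_max_right _ _) (max_le ?_ ?_)
        · by_cases hg : F g = 0
          · simp [hg]
          · exact (Real.log_le_log (norm_pos_iff.2 hg) (hFb g)).trans (le_abs_self _)
        · linarith [abs_nonneg (Real.log B), N.cast_nonneg (α := ℝ)])
  calc Real.log ‖F g₀‖ - C ≤ Real.log (max ‖F g₀‖ (Real.exp (-(N : ℝ)))) - C := by
        linarith [log_le_logTrunc N hpos]
    _ = ∫ _, (Real.log (max ‖F g₀‖ (Real.exp (-(N : ℝ)))) - C) ∂μ := by simp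
    _ ≤ ∫ g, (cs.foldr (fun c ψ g => (2 * π)⁻¹ * ∫ θ in (0)..(2 * π), ψ (g * c θ))
          (fun g => Real.log (max ‖F g‖ (Real.exp (-(N : ℝ))))) g) ∂μ := by
        refine integral_mono (integrable_const _) (Integrable.of_bound hΦm.aestronglyMeasurable _
          (Eventually.of_forall fun g => by rw [Real.norm_eq_abs]; exact hΦb g)) fun g => ?_
        obtain ⟨θs, hl, hθ⟩ := hreach g
        have := le_foldr cs hcs hFm hFb hq N g θs hl
        rwa [hθ] at this
    _ = ∫ g, Real.log (max ‖F g‖ (Real.exp (-(N : ℝ)))) ∂μ := integral_foldr μ cs hcs hφm hφb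
    _ ≤ ∫ g, max (Real.log ‖F g‖) (-(N : ℝ)) ∂μ :=
        integral_mono (Integrable.of_bound hφm.aestronglyMeasurable _
          (Eventually.of_forall fun g => by rw [Real.norm_eq_abs]; exact hφb g)) hmaxint
          fun g => logTrunc_le_max N ‖F g‖

/-- **Integrability of `log ‖F‖`.** Under the hypotheses of `norm_mul_exp_neg_le_exp_integral_log`,
if `F g₀ ≠ 0` then `log ‖F‖` is `μ`-integrable (`le_integral_max_log_norm` and monotone convergence);
in particular the integral in the flatness inequality is a genuine Bochner integral. [folklore] -/
theorem integrable_log_norm (μ : Measure G) [IsProbabilityMeasure μ]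
    [μ.IsMulRightInvariant] (cs : List (ℝ → G)) (hcs : ∀ c ∈ cs, Continuous c) {F : G → ℂ}
    (hFm : Measurable F) {B : ℝ} (hFb : ∀ g, ‖F g‖ ≤ B) {n : ℕ}
    (hq : ∀ c ∈ cs, ∀ g h : G, ∃ q : ℂ[X], q.natDegree ≤ n ∧
      ∀ θ : ℝ, ‖F (g * c θ * h)‖ = ‖q.eval (cexp (θ * I))‖)
    (g₀ : G) (hreach : ∀ g : G, ∃ θs : List ℝ, θs.length = cs.length ∧
      g * (List.zipWith (fun c θ => c θ) cs θs).prod = g₀) (h0 : F g₀ ≠ 0) :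
    Integrable (fun g => Real.log ‖F g‖) μ := by
  refine (integrable_and_le_integral_of_le_integral_max μ (f := fun g => Real.log ‖F g‖)
    (Real.measurable_log.comp hFm.norm) (A := |Real.log B|) (abs_nonneg _) (fun g => ?_)
    (le_integral_max_log_norm μ cs hcs hFm hFb hq g₀ hreach h0)).1
  by_cases hg : F g = 0
  · simp [hg]
  · exact (Real.log_le_log (norm_pos_iff.2 hg) (hFb g)).trans (le_abs_self _)

/-- **Abstract core: Mahler's inequality along circle words.** Let `μ` be a right-invariant
probability measure on `G`, `cs` a list of continuous letters `c : ℝ → G` whose words starting at any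
`g` reach `g₀`, and `F : G → ℂ` bounded measurable such that along every letter, with arbitrary right
factor, `‖F(g c(θ) h)‖ = ‖q(e^{iθ})‖` for a polynomial `q` of degree `≤ n`.  Then
`‖F g₀‖ · 2^{-|cs| n} ≤ exp ∫ log ‖F‖ dμ` (`le_integral_max_log_norm` for every truncation level `N`,
then `N → ∞` by `le_integral_of_le_integral_max`; trivial if `F g₀ = 0`). [folklore] -/
theorem norm_mul_exp_neg_le_exp_integral_log (μ : Measure G) [IsProbabilityMeasure μ]
    [μ.IsMulRightInvariant] (cs : List (ℝ → G)) (hcs : ∀ c ∈ cs, Continuous c) {F : G → ℂ}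
    (hFm : Measurable F) {B : ℝ} (hFb : ∀ g, ‖F g‖ ≤ B) {n : ℕ}
    (hq : ∀ c ∈ cs, ∀ g h : G, ∃ q : ℂ[X], q.natDegree ≤ n ∧
      ∀ θ : ℝ, ‖F (g * c θ * h)‖ = ‖q.eval (cexp (θ * I))‖)
    (g₀ : G) (hreach : ∀ g : G, ∃ θs : List ℝ, θs.length = cs.length ∧
      g * (List.zipWith (fun c θ => c θ) cs θs).prod = g₀) :
    ‖F g₀‖ * Real.exp (-(cs.length * (n * Real.log 2))) ≤ Real.exp (∫ g, Real.log ‖F g‖ ∂μ) := by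
  by_cases h0 : F g₀ = 0
  · rw [h0, norm_zero, zero_mul]; exact (Real.exp_pos _).le
  have hpos : 0 < ‖F g₀‖ := norm_pos_iff.2 h0
  set C : ℝ := cs.length * (n * Real.log 2) with hC
  suffices key : Real.log ‖F g₀‖ - C ≤ ∫ g, Real.log ‖F g‖ ∂μ by
    calc ‖F g₀‖ * Real.exp (-C) = Real.exp (Real.log ‖F g₀‖ - C) := by
          rw [Real.exp_sub, Real.exp_log hpos, Real.exp_neg, div_eq_mul_inv]
      _ ≤ Real.exp (∫ g, Real.log ‖F g‖ ∂μ) := Real.exp_le_exp.2 key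
  refine le_integral_of_le_integral_max μ (f := fun g => Real.log ‖F g‖) (Real.measurable_log.comp hFm.norm)
    (A := |Real.log B|) (abs_nonneg _) (fun g => ?_)
    (le_integral_max_log_norm μ cs hcs hFm hFb hq g₀ hreach h0)
  by_cases hg : F g = 0
  · simp [hg]
  · exact (Real.log_le_log (norm_pos_iff.2 hg) (hFb g)).trans (le_abs_self _)

end Group

end Summit.QuantumFields.QCD.Theorems.SingleLinkLogFlatness

end
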